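import Literature.NumberTheory.LFunctions.HalaszEulerProduct
import HarnessLib

/-!
# Logarithmic moments over smooth numbers: `∑_{p ∣ n ⇒ p ≤ x} (log n)²/n ≪ (log x)³`

Third file of the proof of Theorem 1 of Granville–Soundararajan (sharp Halász).  In the proof of
Lemma 3.2 of the paper the tails `|y| > T` of `∫ |F'(1+α+iy)/(1+α+iy)|² dy` are bounded by the
mean value theorem for Dirichlet series on blocks of length `T`, which produces
`T⁻² ∑_{p ∣ n ⇒ p ≤ x} (log n)²/n^{1+2α} ≪ m³/T²` with `m = min(log x, 1/α)` ((3.11) of the paper,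
stated there without proof).  The tree has the half `≪ 1/α³`
(`Halasz.tsum_mul_norm_term_mulLog_sq_le`); this file supplies the half `≪ (log x)³`, uniformly in
`α > 0`, by an elementary argument with nonnegative Dirichlet convolutions: writing `𝟙̃` for the
indicator of the `(N+1)`-smooth numbers (`N = ⌊x⌋`), `Λ̃ = Λ 𝟙̃`, one has pointwise
`𝟙̃ log ≤ Λ̃ ⋆ 𝟙̃` and `𝟙̃ log² ≤ (Λ̃ log) ⋆ 𝟙̃ + Λ̃ ⋆ (𝟙̃ log)`, and for nonnegative sequences and
the completely multiplicative weight `1/n` the partial sums of a convolution are at most the product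
of the partial sums; the three prime sums are `∑_{smooth} 1/n ≤ e⁵ log x` (tree),
`∑_{p^k, p ≤ N} log p/p^k ≤ 2 ∑_{p ≤ N} log p/p` and `∑_{p^k, p ≤ N} k log² p/p^k ≤ 4 log N ∑_{p ≤ N} log p/p`,
with Mertens' `∑_{p ≤ N} log p/p ≤ log N + log 4` (tree).

## Main results
- `sum_convolution_mul_le` : `∑_{n ≤ M} (a ⋆ b)(n) w(n) ≤ (∑_{k ≤ M} a w)(∑_{m ≤ M} b w)` for `a, b, w ≥ 0`,
  `w` completely multiplicative.
- `sum_smooth_log_sq_div_le` : `∑_{n ≤ M, n smooth} (log n)²/n ≤ C_W (log x)³` (all `M`).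
- `exists_tsum_mul_norm_term_mulLog_sq_le_log` : for `1`-bounded `f`, `0 < α`,
  `∑ n |f̃(n) log n / n^{1+α}|² ≤ C_W (log x)³`.

## References
- [GranvilleSoundararajan2003] A. Granville, K. Soundararajan, *Decay of mean values of
  multiplicative functions*, Canad. J. Math. 55 (2003), §3b, (3.11), arXiv math/9911246 p. 7.

## Design choices
* Everything is real and finite (partial sums over `Finset.Icc 1 M`); the passage to `∑'` is by
  `Real.tsum_le_of_sum_range_le`.  No definitions are introduced (local `set`s only).
-/

noncomputable section

open Finset Real

namespace Literature.NumberTheory.LFunctions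

namespace GranvilleSoundararajan

open Halasz (smoothCut mulLog smoothWeight smoothCut_of_mem smoothCut_of_not_mem norm_smoothCut_le)

/-! ### Nonnegative convolutions: partial sums -/

/-- Pointwise form of `LSeries.convolution`. [folklore] -/
theorem convolution_apply' {R : Type*} [Semiring R] (a b : ℕ → R) (n : ℕ) :
    LSeries.convolution a b n = ∑ p ∈ n.divisorsAntidiagonal, a p.1 * b p.2 := by
  rw [LSeries.convolution_def]


/-- For nonnegative `a b w : ℕ → ℝ` with `w` completely multiplicative,
`∑_{n ≤ M} (a ⋆ b)(n) w(n) ≤ (∑_{k ≤ M} a(k) w(k)) (∑_{m ≤ M} b(m) w(m))` (every pair `k m ≤ M` has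
`k, m ≤ M`). [folklore] -/
theorem sum_convolution_mul_le {a b w : ℕ → ℝ} (ha : ∀ n, 0 ≤ a n) (hb : ∀ n, 0 ≤ b n)
    (hw : ∀ n, 0 ≤ w n) (hwm : ∀ m n, w (m * n) = w m * w n) (M : ℕ) :
    ∑ n ∈ Icc 1 M, LSeries.convolution a b n * w n ≤
      (∑ k ∈ Icc 1 M, a k * w k) * (∑ m ∈ Icc 1 M, b m * w m) := by
  classical
  set F : ℕ × ℕ → ℝ := fun x => (a x.1 * w x.1) * (b x.2 * w x.2) with hF
  have hF0 : ∀ x, 0 ≤ F x := fun x =>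
    mul_nonneg (mul_nonneg (ha _) (hw _)) (mul_nonneg (hb _) (hw _))
  have hexp : ∀ n ∈ Icc 1 M, LSeries.convolution a b n * w n = ∑ x ∈ n.divisorsAntidiagonal, F x := by
    intro n _
    rw [convolution_apply', Finset.sum_mul]
    refine Finset.sum_congr rfl fun x hx => ?_
    have hx' := (Nat.mem_divisorsAntidiagonal.mp hx).1
    simp only [hF]
    rw [← hx', hwm]; ring
  have hdisj : ((Icc 1 M : Finset ℕ) : Set ℕ).PairwiseDisjoint Nat.divisorsAntidiagonal := by
    intro n₁ _ n₂ _ hne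
    simp only [Function.onFun]
    refine Finset.disjoint_left.mpr fun x h1 h2 => hne ?_
    rw [Nat.mem_divisorsAntidiagonal] at h1 h2
    rw [← h1.1, ← h2.1]
  have hsub : (Icc 1 M).biUnion Nat.divisorsAntidiagonal ⊆ Icc 1 M ×ˢ Icc 1 M := by
    intro x hx
    rw [Finset.mem_biUnion] at hx
    obtain ⟨n, hn, hx⟩ := hx
    rw [Finset.mem_Icc] at hn
    rw [Nat.mem_divisorsAntidiagonal] at hx
    obtain ⟨hxn, hn0⟩ := hx
    have h1 : 1 ≤ x.1 := Nat.pos_of_ne_zero fun h => hn0 (by rw [← hxn, h, zero_mul])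
    have h2 : 1 ≤ x.2 := Nat.pos_of_ne_zero fun h => hn0 (by rw [← hxn, h, mul_zero])
    rw [Finset.mem_product, Finset.mem_Icc, Finset.mem_Icc]
    refine ⟨⟨h1, ?_⟩, h2, ?_⟩
    · calc x.1 = x.1 * 1 := (mul_one _).symm
        _ ≤ x.1 * x.2 := Nat.mul_le_mul_left _ h2
        _ ≤ M := hxn ▸ hn.2
    · calc x.2 = 1 * x.2 := (one_mul _).symm
        _ ≤ x.1 * x.2 := Nat.mul_le_mul_right _ h1
        _ ≤ M := hxn ▸ hn.2
  calc ∑ n ∈ Icc 1 M, LSeries.convolution a b n * w n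
      = ∑ n ∈ Icc 1 M, ∑ x ∈ n.divisorsAntidiagonal, F x := Finset.sum_congr rfl hexp
    _ = ∑ x ∈ (Icc 1 M).biUnion Nat.divisorsAntidiagonal, F x := (Finset.sum_biUnion hdisj).symm
    _ ≤ ∑ x ∈ Icc 1 M ×ˢ Icc 1 M, F x := Finset.sum_le_sum_of_subset_of_nonneg hsub (fun x _ _ => hF0 x)
    _ = ∑ k ∈ Icc 1 M, ∑ m ∈ Icc 1 M, (a k * w k) * (b m * w m) := Finset.sum_product _ _ _
    _ = (∑ k ∈ Icc 1 M, a k * w k) * (∑ m ∈ Icc 1 M, b m * w m) := (Finset.sum_mul_sum _ _ _ _).symm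

/-! ### Sums over the prime powers of primes `≤ N` -/

/-- Reindexing a sum over prime powers `d = p^k ≤ M` of primes `p ≤ N` (the prime powers among
the `(N+1)`-smooth numbers) as a double sum over `p ≤ N`, `k ≤ M`, for a nonnegative summand
depending on `(p, k) = (minFac d, v_p(d))`. [folklore] -/
theorem sum_filter_primePow_smooth_le (N M : ℕ) {φ : ℕ → ℕ → ℝ} (hφ : ∀ p k, 0 ≤ φ p k) :
    ∑ d ∈ (Icc 1 M).filter (fun d => IsPrimePow d ∧ d ∈ Nat.smoothNumbers (N + 1)),
        φ d.minFac (d.factorization d.minFac) ≤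
      ∑ p ∈ Icc 1 N, ∑ k ∈ Icc 1 M, φ p k := by
  set s := (Icc 1 M).filter (fun d => IsPrimePow d ∧ d ∈ Nat.smoothNumbers (N + 1)) with hs
  set e : ℕ → ℕ × ℕ := fun d => (d.minFac, d.factorization d.minFac) with he
  have hinj : Set.InjOn e s := by
    intro d₁ hd₁ d₂ hd₂ heq
    have h1 := (Finset.mem_filter.mp hd₁).2.1.minFac_pow_factorization_eq
    have h2 := (Finset.mem_filter.mp hd₂).2.1.minFac_pow_factorization_eq
    simp only [he, Prod.mk.injEq] at heq
    calc d₁ = d₁.minFac ^ d₁.factorization d₁.minFac := h1.symm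
      _ = d₂.minFac ^ d₂.factorization d₂.minFac := by rw [heq.2, heq.1]
      _ = d₂ := h2
  have hmaps : ∀ d ∈ s, e d ∈ Icc 1 N ×ˢ Icc 1 M := by
    intro d hd
    rw [hs, Finset.mem_filter, Finset.mem_Icc] at hd
    obtain ⟨⟨hd1, hdM⟩, hpp, hsm⟩ := hd
    have hp : d.minFac.Prime := Nat.minFac_prime hpp.ne_one
    have hd0 : d ≠ 0 := by omega
    simp only [he, Finset.mem_product, Finset.mem_Icc]
    refine ⟨⟨hp.one_lt.le, ?_⟩, ?_, ?_⟩
    · have hmem : d.minFac ∈ d.primeFactorsList :=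
        (Nat.mem_primeFactorsList hd0).mpr ⟨hp, Nat.minFac_dvd d⟩
      have := (Nat.mem_smoothNumbers.mp hsm).2 _ hmem
      omega
    · rcases Nat.eq_zero_or_pos (d.factorization d.minFac) with h0 | h0
      · have := hpp.minFac_pow_factorization_eq
        rw [h0, pow_zero] at this
        exact absurd this.symm hpp.ne_one
      · exact h0
    · exact ((Nat.factorization_lt d.minFac hd0).le).trans hdM
  calc ∑ d ∈ s, φ d.minFac (d.factorization d.minFac) = ∑ d ∈ s, (fun q : ℕ × ℕ => φ q.1 q.2) (e d) :=
        Finset.sum_congr rfl fun d _ => rfl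
    _ = ∑ q ∈ s.image e, φ q.1 q.2 := (Finset.sum_image (f := fun q : ℕ × ℕ => φ q.1 q.2) hinj).symm
    _ ≤ ∑ q ∈ Icc 1 N ×ˢ Icc 1 M, φ q.1 q.2 :=
        Finset.sum_le_sum_of_subset_of_nonneg (Finset.image_subset_iff.mpr hmaps) (fun q _ _ => hφ q.1 q.2)
    _ = ∑ p ∈ Icc 1 N, ∑ k ∈ Icc 1 M, φ p k := Finset.sum_product _ _ _

/-- For a prime `p` (`r = 1/p ≤ 1/2`): `∑_{1 ≤ k ≤ M} r^k ≤ 2 r`. [folklore] -/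
theorem sum_Icc_inv_pow_le {p : ℕ} (hp : p.Prime) (M : ℕ) :
    ∑ k ∈ Icc 1 M, ((p : ℝ)⁻¹) ^ k ≤ 2 * (p : ℝ)⁻¹ := by
  set r : ℝ := (p : ℝ)⁻¹ with hr
  have hp2 : (2 : ℝ) ≤ p := by exact_mod_cast hp.two_le
  have hp0 : (0 : ℝ) < p := by linarith
  have hr0 : 0 ≤ r := by positivity
  have hr12 : r ≤ 1 / 2 := by
    rw [hr, inv_le_comm₀ hp0 (by norm_num)]; norm_num; exact hp.two_le
  have hr1 : r < 1 := by linarith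
  have hgeom : ∑ j ∈ Finset.range M, r ^ j ≤ 2 := by
    calc ∑ j ∈ Finset.range M, r ^ j ≤ ∑' j : ℕ, r ^ j :=
          (summable_geometric_of_lt_one hr0 hr1).sum_le_tsum _ (fun j _ => by positivity)
      _ = (1 - r)⁻¹ := tsum_geometric_of_lt_one hr0 hr1
      _ ≤ 2 := by rw [inv_le_comm₀ (by linarith) (by norm_num)]; linarith
  rw [show Icc 1 M = Ico 1 (M + 1) by ext k; simp only [mem_Icc, mem_Ico]; omega,
    Finset.sum_Ico_eq_sum_range, show M + 1 - 1 = M by omega]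
  calc ∑ j ∈ Finset.range M, r ^ (1 + j) = r * ∑ j ∈ Finset.range M, r ^ j := by
        rw [Finset.mul_sum]; refine Finset.sum_congr rfl fun j _ => ?_; rw [pow_add, pow_one]
    _ ≤ r * 2 := mul_le_mul_of_nonneg_left hgeom hr0
    _ = 2 * r := mul_comm _ _

/-- For a prime `p` (`r = 1/p ≤ 1/2`): `∑_{1 ≤ k ≤ M} k r^k ≤ 4 r`. [folklore] -/
theorem sum_Icc_mul_inv_pow_le {p : ℕ} (hp : p.Prime) (M : ℕ) :
    ∑ k ∈ Icc 1 M, (k : ℝ) * ((p : ℝ)⁻¹) ^ k ≤ 4 * (p : ℝ)⁻¹ := by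
  set r : ℝ := (p : ℝ)⁻¹ with hr
  have hp2 : (2 : ℝ) ≤ p := by exact_mod_cast hp.two_le
  have hp0 : (0 : ℝ) < p := by linarith
  have hr0 : 0 ≤ r := by positivity
  have hr12 : r ≤ 1 / 2 := by
    rw [hr, inv_le_comm₀ hp0 (by norm_num)]; norm_num; exact hp.two_le
  have hr1 : ‖r‖ < 1 := by rw [Real.norm_of_nonneg hr0]; linarith
  have hsum := (hasSum_coe_mul_geometric_of_norm_lt_one hr1).summable
  calc ∑ k ∈ Icc 1 M, (k : ℝ) * r ^ k ≤ ∑' k : ℕ, (k : ℝ) * r ^ k :=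
        hsum.sum_le_tsum _ (fun k _ => by positivity)
    _ = r / (1 - r) ^ 2 := tsum_coe_mul_geometric_of_norm_lt_one hr1
    _ ≤ r / (1 / 2) ^ 2 := by
        apply div_le_div_of_nonneg_left hr0 (by norm_num)
        nlinarith
    _ = 4 * r := by ring

/-- **`P₁`**: `∑_{d ≤ M, d (N+1)-smooth} Λ(d)/d ≤ 2 ∑_{p ≤ N} log p/p`. [folklore] -/
theorem sum_smooth_vonMangoldt_div_le (N M : ℕ) :
    ∑ d ∈ Icc 1 M, (if d ∈ Nat.smoothNumbers (N + 1) then ArithmeticFunction.vonMangoldt d / d else 0) ≤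
      2 * ∑ p ∈ Nat.primesLE N, Real.log p / p := by
  classical
  have hflt : (Icc 1 N).filter Nat.Prime = Nat.primesLE N := by
    ext p
    simp only [Finset.mem_filter, Finset.mem_Icc, Nat.mem_primesLE]
    exact ⟨fun h => ⟨h.1.2, h.2⟩, fun h => ⟨⟨h.2.one_lt.le, h.1⟩, h.2⟩⟩
  set φ : ℕ → ℕ → ℝ := fun p k => if p.Prime then Real.log p * ((p : ℝ)⁻¹) ^ k else 0 with hφ
  have hφ0 : ∀ p k, 0 ≤ φ p k := by
    intro p k; simp only [hφ]; split_ifs with h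
    · have : (1 : ℝ) ≤ p := by exact_mod_cast h.one_lt.le
      exact mul_nonneg (Real.log_nonneg this) (by positivity)
    · exact le_rfl
  -- restrict to smooth prime powers and identify the summand
  have hres : ∑ d ∈ Icc 1 M, (if d ∈ Nat.smoothNumbers (N + 1) then ArithmeticFunction.vonMangoldt d / d else 0) =
      ∑ d ∈ (Icc 1 M).filter (fun d => IsPrimePow d ∧ d ∈ Nat.smoothNumbers (N + 1)),
        φ d.minFac (d.factorization d.minFac) := by
    rw [Finset.sum_filter]
    refine Finset.sum_congr rfl fun d _ => ?_
    by_cases hsm : d ∈ Nat.smoothNumbers (N + 1)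
    · by_cases hpp : IsPrimePow d
      · have hp : d.minFac.Prime := Nat.minFac_prime hpp.ne_one
        have hdp : d.minFac ^ (d.factorization d.minFac) = d := hpp.minFac_pow_factorization_eq
        rw [if_pos hsm, if_pos ⟨hpp, hsm⟩]
        simp only [hφ, if_pos hp]
        rw [ArithmeticFunction.vonMangoldt_apply, if_pos hpp, inv_pow, div_eq_mul_inv]
        congr 2
        exact_mod_cast hdp.symm
      · rw [if_pos hsm, if_neg (fun h => hpp h.1), ArithmeticFunction.vonMangoldt_eq_zero_iff.mpr hpp, zero_div]
    · rw [if_neg hsm, if_neg (fun h => hsm h.2)]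
  rw [hres]
  refine (sum_filter_primePow_smooth_le N M hφ0).trans ?_
  -- inner geometric sums
  have hinner : ∀ p ∈ Icc 1 N, ∑ k ∈ Icc 1 M, φ p k ≤ if p.Prime then 2 * (Real.log p / p) else 0 := by
    intro p _
    by_cases hp : p.Prime
    · simp only [hφ, if_pos hp]
      rw [← Finset.mul_sum]
      have h1 : (1 : ℝ) ≤ p := by exact_mod_cast hp.one_lt.le
      calc Real.log p * ∑ k ∈ Icc 1 M, ((p : ℝ)⁻¹) ^ k ≤ Real.log p * (2 * (p : ℝ)⁻¹) :=
            mul_le_mul_of_nonneg_left (sum_Icc_inv_pow_le hp M) (Real.log_nonneg h1)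
        _ = 2 * (Real.log p / p) := by ring
    · simp only [hφ, if_neg hp, Finset.sum_const_zero, le_refl]
  calc ∑ p ∈ Icc 1 N, ∑ k ∈ Icc 1 M, φ p k ≤ ∑ p ∈ Icc 1 N, (if p.Prime then 2 * (Real.log p / p) else 0) :=
        Finset.sum_le_sum hinner
    _ = ∑ p ∈ (Icc 1 N).filter Nat.Prime, 2 * (Real.log p / p) := (Finset.sum_filter _ _).symm
    _ = 2 * ∑ p ∈ Nat.primesLE N, Real.log p / p := by rw [hflt, Finset.mul_sum]

/-- **`P₂`**: `∑_{d ≤ M, d (N+1)-smooth} Λ(d) log d/d ≤ 4 log N ∑_{p ≤ N} log p/p`. [folklore] -/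
theorem sum_smooth_vonMangoldt_mul_log_div_le (N M : ℕ) :
    ∑ d ∈ Icc 1 M, (if d ∈ Nat.smoothNumbers (N + 1) then
        ArithmeticFunction.vonMangoldt d * Real.log d / d else 0) ≤
      4 * Real.log N * ∑ p ∈ Nat.primesLE N, Real.log p / p := by
  classical
  have hflt : (Icc 1 N).filter Nat.Prime = Nat.primesLE N := by
    ext p
    simp only [Finset.mem_filter, Finset.mem_Icc, Nat.mem_primesLE]
    exact ⟨fun h => ⟨h.1.2, h.2⟩, fun h => ⟨⟨h.2.one_lt.le, h.1⟩, h.2⟩⟩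
  set φ : ℕ → ℕ → ℝ := fun p k => if p.Prime then Real.log p ^ 2 * ((k : ℝ) * ((p : ℝ)⁻¹) ^ k) else 0
    with hφ
  have hφ0 : ∀ p k, 0 ≤ φ p k := by
    intro p k; simp only [hφ]; split_ifs with h
    · positivity
    · exact le_rfl
  have hres : ∑ d ∈ Icc 1 M, (if d ∈ Nat.smoothNumbers (N + 1) then
        ArithmeticFunction.vonMangoldt d * Real.log d / d else 0) =
      ∑ d ∈ (Icc 1 M).filter (fun d => IsPrimePow d ∧ d ∈ Nat.smoothNumbers (N + 1)),
        φ d.minFac (d.factorization d.minFac) := by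
    rw [Finset.sum_filter]
    refine Finset.sum_congr rfl fun d _ => ?_
    by_cases hsm : d ∈ Nat.smoothNumbers (N + 1)
    · by_cases hpp : IsPrimePow d
      · have hp : d.minFac.Prime := Nat.minFac_prime hpp.ne_one
        have hdp : d.minFac ^ (d.factorization d.minFac) = d := hpp.minFac_pow_factorization_eq
        have hp0 : (0 : ℝ) < d.minFac := by exact_mod_cast hp.pos
        rw [if_pos hsm, if_pos ⟨hpp, hsm⟩]
        simp only [hφ, if_pos hp]
        rw [ArithmeticFunction.vonMangoldt_apply, if_pos hpp]
        have hd_eq : (d : ℝ) = (d.minFac : ℝ) ^ (d.factorization d.minFac) := by exact_mod_cast hdp.symm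
        rw [hd_eq, Real.log_pow, inv_pow]
        field_simp
      · rw [if_pos hsm, if_neg (fun h => hpp h.1), ArithmeticFunction.vonMangoldt_eq_zero_iff.mpr hpp]
        simp
    · rw [if_neg hsm, if_neg (fun h => hsm h.2)]
  rw [hres]
  refine (sum_filter_primePow_smooth_le N M hφ0).trans ?_
  have hinner : ∀ p ∈ Icc 1 N, ∑ k ∈ Icc 1 M, φ p k ≤
      if p.Prime then 4 * Real.log N * (Real.log p / p) else 0 := by
    intro p hpN
    rw [Finset.mem_Icc] at hpN
    by_cases hp : p.Prime
    · simp only [hφ, if_pos hp]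
      rw [← Finset.mul_sum]
      have h1 : (1 : ℝ) ≤ p := by exact_mod_cast hp.one_lt.le
      have hpN' : (p : ℝ) ≤ N := by exact_mod_cast hpN.2
      have hlogp : Real.log p ≤ Real.log N := Real.log_le_log (by linarith) hpN'
      have hlog0 : 0 ≤ Real.log p := Real.log_nonneg h1
      calc Real.log p ^ 2 * ∑ k ∈ Icc 1 M, (k : ℝ) * ((p : ℝ)⁻¹) ^ k
          ≤ Real.log p ^ 2 * (4 * (p : ℝ)⁻¹) :=
            mul_le_mul_of_nonneg_left (sum_Icc_mul_inv_pow_le hp M) (by positivity)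
        _ = 4 * Real.log p * (Real.log p / p) := by ring
        _ ≤ 4 * Real.log N * (Real.log p / p) := by gcongr
    · simp only [hφ, if_neg hp, Finset.sum_const_zero, le_refl]
  calc ∑ p ∈ Icc 1 N, ∑ k ∈ Icc 1 M, φ p k
      ≤ ∑ p ∈ Icc 1 N, (if p.Prime then 4 * Real.log N * (Real.log p / p) else 0) := Finset.sum_le_sum hinner
    _ = ∑ p ∈ (Icc 1 N).filter Nat.Prime, 4 * Real.log N * (Real.log p / p) := (Finset.sum_filter _ _).symm
    _ = 4 * Real.log N * ∑ p ∈ Nat.primesLE N, Real.log p / p := by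
        rw [hflt, Finset.mul_sum]

/-- **`T`**: `∑_{d ≤ M, d smooth} 1/d ≤ e⁵ log x` (`x ≥ 3`, `N = ⌊x⌋`; Mertens, from the tree's
`Halasz.tsum_smoothWeight_le`). [folklore] -/
theorem sum_smooth_inv_le {x : ℝ} (hx : 3 ≤ x) (M : ℕ) :
    ∑ d ∈ Icc 1 M, (if d ∈ Nat.smoothNumbers (⌊x⌋₊ + 1) then (d : ℝ)⁻¹ else 0) ≤
      Real.exp 5 * Real.log x := by
  have hL : 0 < Real.log x := Real.log_pos (by linarith)
  have heq : ∀ d, (if d ∈ Nat.smoothNumbers (⌊x⌋₊ + 1) then (d : ℝ)⁻¹ else 0) = smoothWeight ⌊x⌋₊ 1 d := by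
    intro d; unfold smoothWeight; simp only [Real.rpow_one]
  simp_rw [heq]
  calc ∑ d ∈ Icc 1 M, smoothWeight ⌊x⌋₊ 1 d ≤ ∑' d, smoothWeight ⌊x⌋₊ 1 d :=
        (Halasz.summable_smoothWeight one_pos).sum_le_tsum _ (fun d _ => Halasz.smoothWeight_nonneg 1 d)
    _ ≤ Real.exp (∑ p ∈ Nat.primesBelow (⌊x⌋₊ + 1), ((p : ℝ) ^ (1 : ℝ))⁻¹ + 1) :=
        Halasz.tsum_smoothWeight_le le_rfl
    _ ≤ Real.exp ((Real.log (Real.log x) + 4) + 1) := by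
        apply Real.exp_le_exp.mpr
        have := Halasz.sum_primesLE_inv_le hx
        rw [show Nat.primesBelow (⌊x⌋₊ + 1) = Nat.primesLE ⌊x⌋₊ from rfl]
        simp only [Real.rpow_one, ← one_div]
        linarith
    _ = Real.exp 5 * Real.log x := by
        rw [show Real.log (Real.log x) + 4 + 1 = 5 + Real.log (Real.log x) by ring, Real.exp_add,
          Real.exp_log hL]

/-! ### The pointwise convolution inequalities and the `log²`-moment -/

/-- **The second logarithmic moment over smooth numbers**: there is an absolute `C_W ≥ 0` with
`∑_{n ≤ M, p ∣ n ⇒ p ≤ x} (log n)²/n ≤ C_W (log x)³` for all `x ≥ 3` and all `M`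
(the bound `∑_{p∣n ⇒ p ≤ x} log² n/n^{1+2α} ≪ m³` of GS03 (3.11), in its `α`-uniform half).
[cite: GranvilleSoundararajan2003, §3b (3.11)] -/
theorem sum_smooth_log_sq_div_le :
    ∃ C_W : ℝ, 0 ≤ C_W ∧ ∀ x : ℝ, 3 ≤ x → ∀ M : ℕ,
      ∑ n ∈ Icc 1 M, (if n ∈ Nat.smoothNumbers (⌊x⌋₊ + 1) then Real.log n ^ 2 / n else 0) ≤
        C_W * Real.log x ^ 3 := by
  refine ⟨Real.exp 5 * 48, by positivity, fun x hx M => ?_⟩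
  classical
  set N := ⌊x⌋₊ with hN
  have hx0 : 0 < x := by linarith
  have hN3 : (3 : ℝ) ≤ N := by exact_mod_cast Nat.le_floor hx
  have hNx : (N : ℝ) ≤ x := Nat.floor_le hx0.le
  have hlogN0 : 0 ≤ Real.log N := Real.log_nonneg (by linarith)
  have hlogNx : Real.log N ≤ Real.log x := Real.log_le_log (by linarith) hNx
  have hlx1 : 1 ≤ Real.log x := by
    rw [Real.le_log_iff_exp_le hx0]
    exact le_trans (by have := Real.exp_one_lt_d9; linarith) hx
  have hlog4 : Real.log 4 ≤ 2 * Real.log x := by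
    calc Real.log 4 ≤ Real.log x + Real.log x := by
          rw [← Real.log_mul hx0.ne' hx0.ne']; exact Real.log_le_log (by norm_num) (by nlinarith)
      _ = 2 * Real.log x := by ring
  -- the sequences
  set S := Nat.smoothNumbers (N + 1) with hS
  set one : ℕ → ℝ := fun n => if n ∈ S then 1 else 0 with hone
  set lam : ℕ → ℝ := fun n => one n * ArithmeticFunction.vonMangoldt n with hlam
  set lamlog : ℕ → ℝ := fun n => one n * ArithmeticFunction.vonMangoldt n * Real.log n with hlamlog
  set L1 : ℕ → ℝ := fun n => one n * Real.log n with hL1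
  set w : ℕ → ℝ := fun n => (n : ℝ)⁻¹ with hw
  have hone0 : ∀ n, 0 ≤ one n := fun n => by simp only [hone]; split_ifs <;> norm_num
  have hone1 : ∀ n, one n ≤ 1 := fun n => by simp only [hone]; split_ifs <;> norm_num
  have hlogn0 : ∀ n : ℕ, 0 ≤ Real.log n := fun n => by
    rcases Nat.eq_zero_or_pos n with rfl | hn
    · simp
    · exact Real.log_nonneg (by exact_mod_cast hn)
  have hlam0 : ∀ n, 0 ≤ lam n := fun n => mul_nonneg (hone0 n) ArithmeticFunction.vonMangoldt_nonneg
  have hlamlog0 : ∀ n, 0 ≤ lamlog n := fun n =>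
    mul_nonneg (mul_nonneg (hone0 n) ArithmeticFunction.vonMangoldt_nonneg) (hlogn0 n)
  have hL10 : ∀ n, 0 ≤ L1 n := fun n => mul_nonneg (hone0 n) (hlogn0 n)
  have hw0 : ∀ n, 0 ≤ w n := fun n => by simp only [hw]; positivity
  have hwm : ∀ m n, w (m * n) = w m * w n := fun m n => by simp only [hw]; push_cast; rw [mul_inv]
  -- smooth numbers: divisors of smooth are smooth, `one (k m) = one k * one m` when `k m ∈ S`
  have hdivS : ∀ {n d : ℕ}, n ∈ S → d ∣ n → d ∈ S := fun hn hd =>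
    Nat.mem_smoothNumbers_of_dvd hn hd
  -- (i) `L1 ≤ lam ⋆ one` and (ii) `one · log² ≤ lamlog ⋆ one + lam ⋆ L1`, pointwise on `n ≥ 1`
  have hconv1 : ∀ n, 1 ≤ n → L1 n ≤ LSeries.convolution lam one n := by
    intro n hn
    by_cases hnS : n ∈ S
    · rw [convolution_apply', Nat.sum_divisorsAntidiagonal (f := fun k m => lam k * one m)]
      have h : ∀ d ∈ n.divisors, lam d * one (n / d) = ArithmeticFunction.vonMangoldt d := by
        intro d hd
        have hdn := Nat.dvd_of_mem_divisors hd
        have hd' : d ∈ S := hdivS hnS hdn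
        have hnd : n / d ∈ S := hdivS hnS (Nat.div_dvd_of_dvd hdn)
        simp only [hlam, hone, if_pos hd', if_pos hnd]; ring
      rw [Finset.sum_congr rfl h, ArithmeticFunction.vonMangoldt_sum]
      simp only [hL1, hone, if_pos hnS, one_mul, le_refl]
    · simp only [hL1, hone, if_neg hnS, zero_mul]
      rw [convolution_apply']
      exact Finset.sum_nonneg fun x _ => mul_nonneg (hlam0 _) (hone0 _)
  have hconv2 : ∀ n, 1 ≤ n → one n * Real.log n ^ 2 ≤
      LSeries.convolution lamlog one n + LSeries.convolution lam L1 n := by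
    intro n hn
    by_cases hnS : n ∈ S
    · rw [convolution_apply', convolution_apply', ← Finset.sum_add_distrib,
        Nat.sum_divisorsAntidiagonal (f := fun k m => lamlog k * one m + lam k * L1 m)]
      have hn0 : (n : ℝ) ≠ 0 := by exact_mod_cast (show n ≠ 0 by omega)
      have h : ∀ d ∈ n.divisors, lamlog d * one (n / d) + lam d * L1 (n / d) =
          ArithmeticFunction.vonMangoldt d * Real.log n := by
        intro d hd
        have hdn := Nat.dvd_of_mem_divisors hd
        have hd0 : d ≠ 0 := Nat.ne_of_gt (Nat.pos_of_mem_divisors hd)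
        have hd' : d ∈ S := hdivS hnS hdn
        have hnd : n / d ∈ S := hdivS hnS (Nat.div_dvd_of_dvd hdn)
        have hlogdiv : Real.log ((n / d : ℕ) : ℝ) = Real.log n - Real.log d := by
          rw [Nat.cast_div hdn (by exact_mod_cast hd0), Real.log_div hn0 (by exact_mod_cast hd0)]
        simp only [hlamlog, hlam, hL1, hone, if_pos hd', if_pos hnd]
        rw [hlogdiv]; ring
      rw [Finset.sum_congr rfl h, ← Finset.sum_mul, ArithmeticFunction.vonMangoldt_sum]
      simp only [hone, if_pos hnS]; apply le_of_eq; ring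
    · simp only [hone, if_neg hnS, zero_mul]
      rw [convolution_apply', convolution_apply']
      exact add_nonneg (Finset.sum_nonneg fun x _ => mul_nonneg (hlamlog0 _) (hone0 _))
        (Finset.sum_nonneg fun x _ => mul_nonneg (hlam0 _) (hL10 _))
  -- the four partial sums
  have hT : ∑ m ∈ Icc 1 M, one m * w m ≤ Real.exp 5 * Real.log x := by
    have := sum_smooth_inv_le hx M
    refine le_trans (le_of_eq (Finset.sum_congr rfl fun m _ => ?_)) this
    simp only [hone, hw]; split_ifs <;> simp
  have hM1 := Literature.NumberTheory.LFunctions.MertensBound.sum_log_div_prime_le N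
  have hP₁ : ∑ k ∈ Icc 1 M, lam k * w k ≤ 6 * Real.log x := by
    have h := sum_smooth_vonMangoldt_div_le N M
    have heq : ∑ k ∈ Icc 1 M, lam k * w k =
        ∑ d ∈ Icc 1 M, (if d ∈ Nat.smoothNumbers (N + 1) then ArithmeticFunction.vonMangoldt d / d else 0) :=
      Finset.sum_congr rfl fun d _ => by simp only [hlam, hone, hw, hS]; split_ifs <;> simp [div_eq_mul_inv]
    rw [heq]
    nlinarith
  have hP₂ : ∑ k ∈ Icc 1 M, lamlog k * w k ≤ 12 * Real.log x ^ 2 := by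
    have h := sum_smooth_vonMangoldt_mul_log_div_le N M
    have heq : ∑ k ∈ Icc 1 M, lamlog k * w k = ∑ d ∈ Icc 1 M, (if d ∈ Nat.smoothNumbers (N + 1) then
        ArithmeticFunction.vonMangoldt d * Real.log d / d else 0) :=
      Finset.sum_congr rfl fun d _ => by simp only [hlamlog, hone, hw, hS]; split_ifs <;> simp [div_eq_mul_inv]
    rw [heq]
    have : ∑ p ∈ Nat.primesLE N, Real.log p / p ≤ 3 * Real.log x := by linarith
    calc _ ≤ 4 * Real.log N * ∑ p ∈ Nat.primesLE N, Real.log p / p := h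
      _ ≤ 4 * Real.log x * (3 * Real.log x) := by gcongr
      _ = 12 * Real.log x ^ 2 := by ring
  have hW₁ : ∑ m ∈ Icc 1 M, L1 m * w m ≤ 6 * Real.log x * (Real.exp 5 * Real.log x) := by
    calc ∑ m ∈ Icc 1 M, L1 m * w m ≤ ∑ m ∈ Icc 1 M, LSeries.convolution lam one m * w m :=
          Finset.sum_le_sum fun m hm => mul_le_mul_of_nonneg_right
            (hconv1 m (Finset.mem_Icc.mp hm).1) (hw0 m)
      _ ≤ (∑ k ∈ Icc 1 M, lam k * w k) * (∑ m ∈ Icc 1 M, one m * w m) :=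
          sum_convolution_mul_le hlam0 hone0 hw0 hwm M
      _ ≤ 6 * Real.log x * (Real.exp 5 * Real.log x) :=
          mul_le_mul hP₁ hT (Finset.sum_nonneg fun m _ => mul_nonneg (hone0 m) (hw0 m)) (by positivity)
  -- assemble
  have hmain : ∑ n ∈ Icc 1 M, (if n ∈ S then Real.log n ^ 2 / n else 0) =
      ∑ n ∈ Icc 1 M, one n * Real.log n ^ 2 * w n :=
    Finset.sum_congr rfl fun n _ => by simp only [hone, hw]; split_ifs <;> simp [div_eq_mul_inv]
  rw [hmain]
  calc ∑ n ∈ Icc 1 M, one n * Real.log n ^ 2 * w n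
      ≤ ∑ n ∈ Icc 1 M, (LSeries.convolution lamlog one n + LSeries.convolution lam L1 n) * w n :=
        Finset.sum_le_sum fun n hn => mul_le_mul_of_nonneg_right (hconv2 n (Finset.mem_Icc.mp hn).1) (hw0 n)
    _ = ∑ n ∈ Icc 1 M, LSeries.convolution lamlog one n * w n +
          ∑ n ∈ Icc 1 M, LSeries.convolution lam L1 n * w n := by
        rw [← Finset.sum_add_distrib]; refine Finset.sum_congr rfl fun n _ => ?_; ring
    _ ≤ (∑ k ∈ Icc 1 M, lamlog k * w k) * (∑ m ∈ Icc 1 M, one m * w m) +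
          (∑ k ∈ Icc 1 M, lam k * w k) * (∑ m ∈ Icc 1 M, L1 m * w m) :=
        add_le_add (sum_convolution_mul_le hlamlog0 hone0 hw0 hwm M)
          (sum_convolution_mul_le hlam0 hL10 hw0 hwm M)
    _ ≤ 12 * Real.log x ^ 2 * (Real.exp 5 * Real.log x) +
          6 * Real.log x * (6 * Real.log x * (Real.exp 5 * Real.log x)) := by
        refine add_le_add ?_ ?_
        · exact mul_le_mul hP₂ hT (Finset.sum_nonneg fun m _ => mul_nonneg (hone0 m) (hw0 m)) (by positivity)
        · exact mul_le_mul hP₁ hW₁ (Finset.sum_nonneg fun m _ => mul_nonneg (hL10 m) (hw0 m)) (by positivity)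
    _ = Real.exp 5 * 48 * Real.log x ^ 3 := by ring

/-- **The `log³`-half of GS03 (3.11)**: with `c_n = f̃(n) log n / n^{1+α}` (`f` `1`-bounded,
`f̃` its `(⌊x⌋+1)`-smooth truncation, `α > 0`), `∑ n |c_n|² ≤ C_W (log x)³`; together with the
tree's `∑ n |c_n|² ≤ 4e^{10}/α³` this is `∑_{p∣n ⇒ p≤x} log² n/n^{1+2α} ≪ min(log x, 1/α)³`.
[cite: GranvilleSoundararajan2003, §3b (3.11)] -/
theorem exists_tsum_mul_norm_term_mulLog_sq_le_log :
    ∃ C_W : ℝ, 0 ≤ C_W ∧ ∀ f : ℕ → ℂ, (∀ n, ‖f n‖ ≤ 1) → ∀ x : ℝ, 3 ≤ x → ∀ α : ℝ, 0 < α →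
      ∑' n : ℕ, (n : ℝ) * ‖LSeries.term (mulLog f ⌊x⌋₊) (1 + α) n‖ ^ 2 ≤ C_W * Real.log x ^ 3 := by
  obtain ⟨C_W, hC0, hC⟩ := sum_smooth_log_sq_div_le
  refine ⟨C_W, hC0, fun f hfb x hx α hα => ?_⟩
  classical
  set N := ⌊x⌋₊ with hN
  set G : ℕ → ℝ := fun n => if n ∈ Nat.smoothNumbers (N + 1) then Real.log n ^ 2 / n else 0 with hG
  have hG0 : ∀ n, 0 ≤ G n := fun n => by
    simp only [hG]; split_ifs
    · rcases Nat.eq_zero_or_pos n with rfl | hn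
      · simp
      · exact div_nonneg (sq_nonneg _) (Nat.cast_nonneg n)
    · exact le_rfl
  have hle : ∀ n : ℕ, (n : ℝ) * ‖LSeries.term (mulLog f N) (1 + α) n‖ ^ 2 ≤ G n := by
    intro n
    rcases Nat.eq_zero_or_pos n with rfl | hn
    · simp [hG0]
    · have hn0 : (0 : ℝ) < n := by exact_mod_cast hn
      rw [LSeries.term_of_ne_zero hn.ne', norm_div, Complex.norm_natCast_cpow_of_pos hn]
      simp only [Complex.add_re, Complex.one_re, Complex.ofReal_re]
      unfold mulLog
      by_cases hsm : n ∈ Nat.smoothNumbers (N + 1)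
      · simp only [hG, if_pos hsm]
        rw [norm_mul, Complex.norm_real, Real.norm_of_nonneg (Real.log_nonneg (by exact_mod_cast hn))]
        have h1 : ‖smoothCut f N n‖ ≤ 1 := norm_smoothCut_le hfb n
        have hpow : (n : ℝ) ^ (1 + α) = n * (n : ℝ) ^ α := by
          rw [Real.rpow_add hn0, Real.rpow_one]
        have hnα : 1 ≤ (n : ℝ) ^ α := Real.one_le_rpow (by exact_mod_cast hn) hα.le
        rw [hpow, div_pow, mul_pow, mul_pow]
        have hlog0 : 0 ≤ Real.log n := Real.log_nonneg (by exact_mod_cast hn)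
        calc (n : ℝ) * (‖smoothCut f N n‖ ^ 2 * Real.log n ^ 2 / ((n : ℝ) ^ 2 * ((n : ℝ) ^ α) ^ 2))
            ≤ (n : ℝ) * (1 ^ 2 * Real.log n ^ 2 / ((n : ℝ) ^ 2 * 1 ^ 2)) := by
              gcongr
            _ = Real.log n ^ 2 / n := by field_simp
      · simp only [hG, if_neg hsm]
        rw [smoothCut_of_not_mem hsm]
        simp
  have hrange : ∀ n : ℕ, ∑ i ∈ Finset.range n, (i : ℝ) * ‖LSeries.term (mulLog f N) (1 + α) i‖ ^ 2 ≤
      C_W * Real.log x ^ 3 := by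
    intro n
    calc ∑ i ∈ Finset.range n, (i : ℝ) * ‖LSeries.term (mulLog f N) (1 + α) i‖ ^ 2
        ≤ ∑ i ∈ Finset.range n, G i := Finset.sum_le_sum fun i _ => hle i
      _ ≤ ∑ i ∈ Icc 0 n, G i :=
          Finset.sum_le_sum_of_subset_of_nonneg (fun i hi => by
            rw [Finset.mem_range] at hi; rw [Finset.mem_Icc]; omega) (fun i _ _ => hG0 i)
      _ = G 0 + ∑ i ∈ Icc 1 n, G i := by
          rw [Finset.Icc_eq_cons_Ioc (Nat.zero_le n), Finset.sum_cons]
          rfl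
      _ = ∑ i ∈ Icc 1 n, G i := by
          have : G 0 = 0 := by simp [hG]
          rw [this, zero_add]
      _ ≤ C_W * Real.log x ^ 3 := hC x hx n
  exact Real.tsum_le_of_sum_range_le (fun n => by positivity) hrange

end GranvilleSoundararajan

end Literature.NumberTheory.LFunctions
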